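import Literature.MathematicalPhysics.QuantumFieldTheory.Balaban1983to89.Beta.DressedMomentNormalisation

/-!
# `BalabanUV.Beta.D1BFx.MomentTransferPeriodic` — road «BF-x» for binder row D1, leaf K-R5 (part 1):
# THE DECIMATED SECOND MOMENT OF A TWO-SIDED DRESSED SUM WITH A **BLOCK-PERIODIC** (NOT translation-invariant)
# FINE KERNEL — the nine-term master identity with every cross term an EXPLICIT FINITE SUM OVER BASE POINTS,
# and its vanishing form: (masses) × Σ_{base points} (fine second moment)

HONEST FRAMING (cell contract, verbatim): «discharging `BetaPertH` makes Bałaban's UV stability UNCONDITIONAL — a real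
constructive-QFT result; it is NOT the continuum limit and NOT the Clay problem.»  This module is [folklore] bookkeeping
of unconditionally convergent lattice sums over `ℝ`; it GENERALISES, and cites BY NAME the engine of,
`Beta.DecimatedMomentSummable` (b12-g12) / `Beta.DressedMomentNormalisation` (an2-g5): there the fine kernel is
translation invariant, `T (s − s')`; here it is a two-point kernel `P s s'` that is only JOINTLY PERIODIC under the block
lattice, `P (s + N•z) (s' + N•z) = P s s'`.  Nothing of the manuscripts under audit ([Balaban1987RG1] = B12 and
companions) is asserted or cited; no `def … : Prop` fact is minted; nothing of the wall (D1 / BetaPertH) is discharged.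
Value = kernel bookkeeping leaf of road BF-x, NOT summit progress; NOT continuum, NOT Clay.
HONEST DEPENDENCY (verbatim): continuum YM on T⁴ ⇐ BetaPertH ∧ nine spine estimates (0/9 proved); BetaPertH ⇐ (D1) ∧
(D4) ∧ CAP+tail; G-an2-4 gates asym, D1 and NE2/3/4.

WHY (skeleton `HOME/beta/skeletons/D1-b2b-balaban-beta-d1-p2.md` v1.4 node R, leaf R5 «MOMENT TRANSFER»; typer brief
`HOME/b2b-balaban-beta-d1-p2/TYPER-SPEC-D1BFx.md` §2 K-R5).  On road BF-x the one-shot coarse kernel is the sandwich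
`ℋ_nᵀ · P_n · ℋ_n` of the FINE-LEVEL `A`-Hessian kernel `P_n(s, s')` of the one-shot functional at `U = 1` between two
copies of the linearised minimiser; `P_n` is NOT translation invariant on the fine lattice, only block periodic.  K-R5
asks: generalise `DressedMomentNormalisation.secondMoment_dressedEntry_hasSum_lattice` to that case; conclusion = masses ×
the BASE-POINT AVERAGE `N^{−d} Σ_{b ∈ box N} Σ'_t t_κ t_λ P (b + t) b` of the fine second moment, with the cross terms of
`MomentFactorisation.M2_dressed_ward` made explicit as finite sums over base points.  THIS FILE is the fine-point
(triple-family) form; `MomentTransferPeriodicSum` carries the summability discharge, the coarse / lattice / matrix-entry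
forms and the normalisation; `MomentTransferPeriodicMaster` the nine-term identity itself (this file: §1 objects and
residues, §2 the collapse lemmas).

THE COMPUTATION (our bookkeeping; ½ page).  Coarse output point `y`, left relative position `u`, right relative position
`x`, fine displacement `t = (y + u) − x`; the sandwich at `y ∈ N•ℤ^d` is `K(y) = Σ_{u,x} w u · P (y + u) x · w' x`, so the
triple family is `(cosetInd N (t+x−u) · g) • (w u · P (x + t) x · w' x)` — the translation-invariant family with `T t`
replaced by the BASE-POINT kernel `baseKer P x t = P (x + t) x`, periodic in the base point `x`.  Of the nine monomials of
`(t + x − u)_κ (t + x − u)_λ`, eight are collapsed on the LEFT index `u` by (L0∞)/(L1∞) exactly as before (the kernel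
factor does not see `u`), leaving `Σ_x (r x • w' x) · ρ · m_q(x)` with `m_q(b) = Σ_t q t • P (b+t) b` periodic in `b`:
splitting `x` over the `N^d` residue classes and using the right pattern's coset moments ((R0∞): mass `σ'` on every
class; (R1∞): first moment `C'` on every class) gives `ρ · Σ_{classes b} m_q(b) · ν_r(b)`.  The ninth, `u_κ u_λ`, is
collapsed on the RIGHT index `x`: on the window `x ≡ u − t (N)` periodicity freezes the kernel at `P u (u − t)`, the
class mass is `σ'`, and the remaining `t`-sum is the ROW SUM `Σ_{s'} P u s'`.  Hence the nine-term identity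
`hasSum_termP_second` below, and under «columns and rows of `P` sum to zero at every point» (the kernel kills constants
on both sides) + «base-point-AVERAGED first moments vanish» + (L1∞)/(R1∞) on both patterns, ONLY THE MAIN TERM
survives: `σ · σ' · Σ_{b} Σ_t t_κ t_λ P (b+t) b` (`hasSum_termP_second_of_vanishing`).  For `P s s' = T (s − s')` every
object here IS the corresponding object of `DecimatedMomentSummable` (`termP_of_transl`, §1).

CONTENT (all [folklore], over `ℝ`, `d` and `N` general):
* §1 `Ker₂`, `IsBlockPeriodic`, `baseKer`, `termP`, consistency with `DecimatedMomentSummable.term`; residues: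
  `exists_eq_zsmul_of_cosetInd_ne_zero`, `eq_resSite_add`, `periodic_apply_eq_resSite`, `hasSum_classSplit`.
* §2 LEFT collapse `hasSum_fibre_leftP`, `hasSum_termP_left` (value `ρ · Σ_b m_q(b) ν_r(b)`), `hasSum_termP_left_of_zero`;
  RIGHT collapse `hasSum_fibre_rightP`, `hasSum_termP_right` (value `σ' · Σ_b R₀(b) π_p(b)`), `hasSum_termP_right_of_zero`.
* (§3, file `MomentTransferPeriodicMaster`) `MonoSummableP`, the nine-term `hasSum_termP_second`,
  `hasSum_termP_second_of_vanishing`; (part 2, file `MomentTransferPeriodicSum`) summability over `ℝ`, coarse /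
  lattice / matrix-entry forms, the base-point-average normalisation, (T1-avg) from symmetry.
-/

namespace Summit.QuantumFields.BalabanUV.Beta.D1BFx.MomentTransferPeriodic

open Finset Filter Topology
open Literature.MathematicalPhysics.QuantumFieldTheory.Balaban1983to89
open Literature.MathematicalPhysics.QuantumFieldTheory.Balaban1983to89.Beta
open DecimatedMoment (cosetInd cosetInd_sub_comm smul_pull_left smul_pull_right)
open DecimatedMomentSummable (term mono IsMoment₂ second_weight_expand ConstReproSum LinReproSum constReproSum_iff_right)
open DressedMomentNormalisation (resSite resOf resSite_resOf dvd_resSite_sub_iff cosetInd_resSite_sub sum_cosetInd_resSite)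

variable {d N : ℕ}

/-! ## §1 Two-point fine kernels, block periodicity, the base-point kernel, the triple family -/

/-- A TWO-POINT fine kernel `P s s'` (real scalar; a matrix kernel is handled entrywise in part 2). [folklore] -/
abbrev Ker₂ (d : ℕ) : Type := (Fin d → ℤ) → (Fin d → ℤ) → ℝ

/-- JOINT block periodicity: `P (s + N•z) (s' + N•z) = P s s'`. [folklore] -/
def IsBlockPeriodic (N : ℕ) (P : Ker₂ d) : Prop :=
  ∀ z s s' : Fin d → ℤ, P (s + (N : ℤ) • z) (s' + (N : ℤ) • z) = P s s'

/-- The BASE-POINT kernel: `baseKer P b t = P (b + t) b` — the column of `P` at the base point `b`, read as a function of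
the displacement `t` (for `P s s' = T (s − s')` this is `T`, for every `b`). [folklore] -/
def baseKer (P : Ker₂ d) (b t : Fin d → ℤ) : ℝ := P (b + t) b

/-- The TRIPLE FAMILY of the `N•ℤ^d`-windowed dressed sum with a two-point kernel, index `q = (u, (t, x))`:
`(cosetInd N (t+x−u) · g u t x) • (w u · P (x + t) x · w' x)`. [folklore] -/
def termP (N : ℕ) (w : (Fin d → ℤ) → ℝ) (P : Ker₂ d) (w' : (Fin d → ℤ) → ℝ)
    (g : (Fin d → ℤ) → (Fin d → ℤ) → (Fin d → ℤ) → ℤ) (q : (Fin d → ℤ) × (Fin d → ℤ) × (Fin d → ℤ)) : ℝ :=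
  (cosetInd N (q.2.1 + q.2.2 - q.1) * g q.1 q.2.1 q.2.2) • (w q.1 * P (q.2.2 + q.2.1) q.2.2 * w' q.2.2)

/-- Unfolding at a triple. [folklore] -/
theorem termP_apply (w : (Fin d → ℤ) → ℝ) (P : Ker₂ d) (w' : (Fin d → ℤ) → ℝ)
    (g : (Fin d → ℤ) → (Fin d → ℤ) → (Fin d → ℤ) → ℤ) (u t x : Fin d → ℤ) :
    termP N w P w' g (u, t, x) = (cosetInd N (t + x - u) * g u t x) • (w u * P (x + t) x * w' x) := rfl

/-- `termP` is additive in the integer weight. [folklore] -/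
theorem termP_add (w : (Fin d → ℤ) → ℝ) (P : Ker₂ d) (w' : (Fin d → ℤ) → ℝ)
    (g h : (Fin d → ℤ) → (Fin d → ℤ) → (Fin d → ℤ) → ℤ) :
    termP N w P w' (g + h) = termP N w P w' g + termP N w P w' h := by
  funext q
  simp only [termP, Pi.add_apply, mul_add, add_smul]

/-- `termP` is subtractive in the integer weight. [folklore] -/
theorem termP_sub (w : (Fin d → ℤ) → ℝ) (P : Ker₂ d) (w' : (Fin d → ℤ) → ℝ)
    (g h : (Fin d → ℤ) → (Fin d → ℤ) → (Fin d → ℤ) → ℤ) :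
    termP N w P w' (g - h) = termP N w P w' g - termP N w P w' h := by
  funext q
  simp only [termP, Pi.sub_apply, mul_sub, sub_smul]

/-- CONSISTENCY: for a translation-invariant kernel `P s s' = T (s − s')` the triple family IS
`DecimatedMomentSummable.term (cosetInd N) w T w'`. [folklore] -/
theorem termP_of_transl (w T w' : (Fin d → ℤ) → ℝ) (g : (Fin d → ℤ) → (Fin d → ℤ) → (Fin d → ℤ) → ℤ) :
    termP N w (fun s s' => T (s - s')) w' g = term (cosetInd N) w T w' g := by
  funext q
  obtain ⟨u, t, x⟩ := q
  rw [termP_apply, DecimatedMomentSummable.term_apply, add_sub_cancel_left]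

/-- … and its base-point kernel is `T` at every base point. [folklore] -/
theorem baseKer_of_transl (T : (Fin d → ℤ) → ℝ) (b : Fin d → ℤ) : baseKer (fun s s' => T (s - s')) b = T := by
  funext t
  simp only [baseKer, add_sub_cancel_left]

/-- A translation-invariant kernel is block periodic for every `N`. [folklore] -/
theorem isBlockPeriodic_of_transl (T : (Fin d → ℤ) → ℝ) : IsBlockPeriodic N (fun s s' => T (s - s')) := by
  intro z s s'
  simp only [add_sub_add_right_eq_sub]

/-- Block periodicity of the base-point kernel in the base point. [folklore] -/
theorem baseKer_add_zsmul {P : Ker₂ d} (hP : IsBlockPeriodic N P) (b z : Fin d → ℤ) :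
    baseKer P (b + (N : ℤ) • z) = baseKer P b := by
  funext t
  simp only [baseKer]
  rw [show b + (N : ℤ) • z + t = (b + t) + (N : ℤ) • z by abel, hP z]

/-- On the support of the window `cosetInd N y` the point `y` is an `N`-multiple. [folklore] -/
theorem exists_eq_zsmul_of_cosetInd_ne_zero {y : Fin d → ℤ} (h : cosetInd N y ≠ 0) :
    ∃ z : Fin d → ℤ, y = (N : ℤ) • z := by
  unfold cosetInd at h
  by_cases hy : ∀ i, (N : ℤ) ∣ y i
  · choose c hc using hy
    exact ⟨c, funext fun i => by rw [Pi.smul_apply, smul_eq_mul]; exact hc i⟩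
  · exact absurd (if_neg hy) h

/-- Every lattice point is its residue site plus an `N`-multiple (`0 < N`). [folklore] -/
theorem eq_resSite_add (hN : 0 < N) (u : Fin d → ℤ) :
    ∃ z : Fin d → ℤ, u = resSite (resOf hN u) + (N : ℤ) • z := by
  have h : ∀ i, (N : ℤ) ∣ (resSite (resOf hN u) - u) i := (dvd_resSite_sub_iff hN _ u).2 rfl
  choose c hc using h
  refine ⟨-c, funext fun i => ?_⟩
  have hi := hc i
  simp only [Pi.sub_apply] at hi
  simp only [Pi.add_apply, Pi.smul_apply, smul_eq_mul, Pi.neg_apply, mul_neg]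
  linarith

/-- A block-periodic function takes at `u` its value at the residue site of `u`. [folklore] -/
theorem periodic_apply_eq_resSite (hN : 0 < N) {m : (Fin d → ℤ) → ℝ} (hm : ∀ b z : Fin d → ℤ, m (b + (N : ℤ) • z) = m b)
    (u : Fin d → ℤ) : m u = m (resSite (resOf hN u)) := by
  obtain ⟨z, hz⟩ := eq_resSite_add hN u
  conv_lhs => rw [hz]
  exact hm _ z

/-- **CLASS SPLITTING.**  A block-periodic factor `m` times a windowed-moment family of a pattern: if every residue-class
family `x ↦ (cosetInd N (a − x) · r x) • w' x` has the sum `ν a`, then `x ↦ (r x • w' x) · (ρ · m x)` has the sum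
`ρ · Σ_{classes b} m b · ν b` (split `x` over the `N^d` classes; `sum_cosetInd_resSite`). [folklore] -/
theorem hasSum_classSplit (hN : 0 < N) {w' : (Fin d → ℤ) → ℝ} {r : (Fin d → ℤ) → ℤ} {ν : (Fin d → ℤ) → ℝ}
    (hR : ∀ a, HasSum (fun x => (cosetInd N (a - x) * r x) • w' x) (ν a)) {m : (Fin d → ℤ) → ℝ}
    (hm : ∀ b z : Fin d → ℤ, m (b + (N : ℤ) • z) = m b) (ρ : ℝ) :
    HasSum (fun x => (r x • w' x) * (ρ * m x))
      (ρ * ∑ b : Fin d → Fin N, m (resSite b) * ν (resSite b)) := by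
  have hs := hasSum_sum (s := (Finset.univ : Finset (Fin d → Fin N)))
    (f := fun b x => (ρ * m (resSite b)) * ((cosetInd N (resSite b - x) * r x) • w' x))
    (a := fun b => (ρ * m (resSite b)) * ν (resSite b)) (fun b _ => (hR (resSite b)).mul_left _)
  have hval : ∑ b : Fin d → Fin N, ρ * m (resSite b) * ν (resSite b)
      = ρ * ∑ b : Fin d → Fin N, m (resSite b) * ν (resSite b) := by
    rw [Finset.mul_sum]
    refine Finset.sum_congr rfl (fun b _ => ?_)
    ring
  rw [hval] at hs
  refine hs.congr_fun (fun x => ?_)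
  -- only the class of `x` contributes
  simp only [cosetInd_resSite_sub hN, ite_mul, one_mul, zero_mul, ite_smul, zero_smul, mul_ite, mul_zero,
    Finset.sum_ite_eq', Finset.mem_univ, if_true]
  rw [← periodic_apply_eq_resSite hN hm x]
  ring

/-! ## §2 Collapsing one index: LEFT by (L0∞)/(L1∞), then the base-point classes; RIGHT by (R0∞) and periodicity -/

section Collapse

variable (w : (Fin d → ℤ) → ℝ) (P : Ker₂ d) (w' : (Fin d → ℤ) → ℝ)

/-- **LEFT COLLAPSE** (fibres over `(t, x)`, inner index `u`; verbatim the translation-invariant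
`DecimatedMomentSummable.hasSum_fibre_left` — the kernel factor `P (x + t) x` does not see `u`).  Weight `pw u · (q t · r x)`;
hypothesis: every window family `u ↦ (cosetInd N (a − u) · pw u) • w u` has the sum `ρ` ((L0∞): `pw = 1, ρ = σ`; (L1∞)_κ:
`pw = u_κ, ρ = C κ`).  The factorised fibre-sum family `(t, x) ↦ (q t • (ρ · P (x+t) x)) · (r x • w' x)` has the sum
`Σ' termP`. [folklore] -/
theorem hasSum_fibre_leftP {ρ : ℝ} (pw : (Fin d → ℤ) → ℤ)
    (hL : ∀ a, HasSum (fun u => (cosetInd N (a - u) * pw u) • w u) ρ) (q r : (Fin d → ℤ) → ℤ)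
    (hS : Summable (termP N w P w' (mono pw q r))) :
    HasSum (fun p : (Fin d → ℤ) × (Fin d → ℤ) => (q p.1 • (ρ * P (p.2 + p.1) p.2)) * (r p.2 • w' p.2))
      (∑' s, termP N w P w' (mono pw q r) s) := by
  set f := termP N w P w' (mono pw q r) with hf
  have hF : HasSum (f ∘ ⇑(Equiv.prodComm ((Fin d → ℤ) × (Fin d → ℤ)) (Fin d → ℤ))) (∑' s, f s) :=
    (Equiv.hasSum_iff _).mpr hS.hasSum
  have hfib : ∀ p : (Fin d → ℤ) × (Fin d → ℤ),
      HasSum (fun u => (f ∘ ⇑(Equiv.prodComm ((Fin d → ℤ) × (Fin d → ℤ)) (Fin d → ℤ))) (p, u))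
        ((q p.1 * r p.2) • (ρ * P (p.2 + p.1) p.2 * w' p.2)) := by
    intro p
    have h := (((hL (p.1 + p.2)).mul_right (P (p.2 + p.1) p.2)).mul_right (w' p.2)).const_smul (q p.1 * r p.2)
    refine h.congr_fun (fun u => ?_)
    simp only [Function.comp_apply, Equiv.prodComm_apply, Prod.swap_prod_mk, hf, termP, mono, ← mul_assoc]
    rw [mul_assoc (cosetInd N _ * pw u) (q _) (r _)]
    exact smul_pull_left _ _ _ _ _
  have hG := hF.prod_fiberwise hfib
  refine hG.congr_fun (fun p => ?_)
  rw [smul_mul_smul_comm, mul_assoc]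

/-- LEFT COLLAPSE, second fibration (fibres over `x`, inner index `t`): with the base-point moments
`m b = Σ_t q t • P (b+t) b` the family `x ↦ (r x • w' x) · (ρ · m x)` has the sum `Σ' termP`. [folklore] -/
theorem hasSum_fibre_leftP' {ρ : ℝ} (pw : (Fin d → ℤ) → ℤ)
    (hL : ∀ a, HasSum (fun u => (cosetInd N (a - u) * pw u) • w u) ρ) (q r : (Fin d → ℤ) → ℤ)
    {m : (Fin d → ℤ) → ℝ} (hq : ∀ b, HasSum (fun t => q t • baseKer P b t) (m b))
    (hS : Summable (termP N w P w' (mono pw q r))) :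
    HasSum (fun x => (r x • w' x) * (ρ * m x)) (∑' s, termP N w P w' (mono pw q r) s) := by
  have hG := hasSum_fibre_leftP w P w' pw hL q r hS
  have hG' := (Equiv.hasSum_iff (Equiv.prodComm (Fin d → ℤ) (Fin d → ℤ))).mpr hG
  refine hG'.prod_fiberwise (fun x => ?_)
  have h := ((hq x).mul_left ρ).mul_right (r x • w' x)
  rw [show (r x • w' x) * (ρ * m x) = ρ * m x * (r x • w' x) by ring]
  refine h.congr_fun (fun t => ?_)
  simp only [Function.comp_apply, Equiv.prodComm_apply, Prod.swap_prod_mk, baseKer]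
  rw [mul_smul_comm (q t) ρ (P (x + t) x)]

/-- **LEFT COLLAPSE WITH CLASS SPLITTING** (`0 < N`, `P` block periodic): if moreover every residue-class family
`x ↦ (cosetInd N (a − x) · r x) • w' x` has the sum `ν a` ((R0∞): `r = 1, ν = σ'`; (R1∞)_λ: `r = x_λ, ν = C' λ`; any
coset moment in general), the triple family with weight `pw u · q t · r x` HAS THE SUM
`ρ · Σ_{b : classes} m b · ν b` — an explicit FINITE sum over the `N^d` base points `resSite b`. [folklore] -/
theorem hasSum_termP_left (hN : 0 < N) (hP : IsBlockPeriodic N P) {ρ : ℝ} (pw : (Fin d → ℤ) → ℤ)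
    (hL : ∀ a, HasSum (fun u => (cosetInd N (a - u) * pw u) • w u) ρ) (q r : (Fin d → ℤ) → ℤ)
    {m : (Fin d → ℤ) → ℝ} (hq : ∀ b, HasSum (fun t => q t • baseKer P b t) (m b))
    {ν : (Fin d → ℤ) → ℝ} (hR : ∀ a, HasSum (fun x => (cosetInd N (a - x) * r x) • w' x) (ν a))
    (hS : Summable (termP N w P w' (mono pw q r))) :
    HasSum (termP N w P w' (mono pw q r)) (ρ * ∑ b : Fin d → Fin N, m (resSite b) * ν (resSite b)) := by
  have hG := hasSum_fibre_leftP' w P w' pw hL q r hq hS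
  have hm : ∀ b z : Fin d → ℤ, m (b + (N : ℤ) • z) = m b := by
    intro b z
    have h1 := hq (b + (N : ℤ) • z)
    rw [baseKer_add_zsmul hP] at h1
    exact h1.unique (hq b)
  exact hG.unique (hasSum_classSplit hN hR hm ρ) ▸ hS.hasSum

/-- LEFT COLLAPSE WHEN THE KERNEL MOMENT VANISHES AT EVERY BASE POINT (`Σ_t q t • P (b+t) b = 0` for all `b`): the
triple family has the sum `0`, with NO hypothesis on `w'` and no periodicity needed. [folklore] -/
theorem hasSum_termP_left_of_zero {ρ : ℝ} (pw : (Fin d → ℤ) → ℤ)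
    (hL : ∀ a, HasSum (fun u => (cosetInd N (a - u) * pw u) • w u) ρ) (q r : (Fin d → ℤ) → ℤ)
    (hq : ∀ b, HasSum (fun t => q t • baseKer P b t) 0) (hS : Summable (termP N w P w' (mono pw q r))) :
    HasSum (termP N w P w' (mono pw q r)) 0 := by
  have hG := hasSum_fibre_leftP' w P w' pw hL q r (m := fun _ => 0) hq hS
  have h0 : HasSum (fun _ : Fin d → ℤ => (0 : ℝ)) (∑' s, termP N w P w' (mono pw q r) s) := by
    simpa only [mul_zero] using hG
  exact h0.unique hasSum_zero ▸ hS.hasSum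

/-- On the window `x ≡ u − t (N)` block periodicity FREEZES the kernel factor:
`cosetInd N (t + x − u) · P (x + t) x = cosetInd N (x − (u − t)) · P u (u − t)`. [folklore] -/
theorem cosetInd_mul_kernel_eq (hP : IsBlockPeriodic N P) (u t x : Fin d → ℤ) :
    (cosetInd N (t + x - u) : ℝ) * P (x + t) x = (cosetInd N (x - (u - t)) : ℝ) * P u (u - t) := by
  have e : t + x - u = x - (u - t) := by abel
  rw [e]
  by_cases h : cosetInd N (x - (u - t)) = 0
  · rw [h, Int.cast_zero, zero_mul, zero_mul]
  · obtain ⟨z, hz⟩ := exists_eq_zsmul_of_cosetInd_ne_zero h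
    have hx : x = (u - t) + (N : ℤ) • z := by rw [← hz]; abel
    rw [hx, show u - t + (N : ℤ) • z + t = u + (N : ℤ) • z by abel, hP z u (u - t)]

/-- **RIGHT COLLAPSE** (fibres over `(u, t)`, inner index `x`; weight `p u · 1 · 1`; hypothesis (R0∞): every family
`x ↦ cosetInd N (x − a) • w' x` has the sum `σ'`): the fibre-sum family `(u, t) ↦ (p u • w u) · (P u (u − t) · σ')`
has the sum `Σ' termP` — the kernel frozen at `P u (u − t)` by `cosetInd_mul_kernel_eq`. [folklore] -/
theorem hasSum_fibre_rightP (hP : IsBlockPeriodic N P) {σ' : ℝ}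
    (hR0 : ∀ a, HasSum (fun x => cosetInd N (x - a) • w' x) σ') (p : (Fin d → ℤ) → ℤ)
    (hS : Summable (termP N w P w' (mono p (fun _ => 1) (fun _ => 1)))) :
    HasSum (fun m : (Fin d → ℤ) × (Fin d → ℤ) => (p m.1 • w m.1) * (P m.1 (m.1 - m.2) * σ'))
      (∑' s, termP N w P w' (mono p (fun _ => 1) (fun _ => 1)) s) := by
  set f := termP N w P w' (mono p (fun _ => 1) (fun _ => 1)) with hf
  have hF : HasSum (f ∘ ⇑(Equiv.prodAssoc (Fin d → ℤ) (Fin d → ℤ) (Fin d → ℤ))) (∑' s, f s) :=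
    (Equiv.hasSum_iff _).mpr hS.hasSum
  have hfib : ∀ m : (Fin d → ℤ) × (Fin d → ℤ),
      HasSum (fun x => (f ∘ ⇑(Equiv.prodAssoc (Fin d → ℤ) (Fin d → ℤ) (Fin d → ℤ))) (m, x))
        ((p m.1 • w m.1) * (P m.1 (m.1 - m.2) * σ')) := by
    intro m
    have h := ((hR0 (m.1 - m.2)).mul_left (w m.1 * P m.1 (m.1 - m.2))).const_smul (p m.1)
    rw [show (p m.1 • w m.1) * (P m.1 (m.1 - m.2) * σ') = p m.1 • (w m.1 * P m.1 (m.1 - m.2) * σ') by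
      rw [smul_mul_assoc, mul_assoc]]
    refine h.congr_fun (fun x => ?_)
    simp only [Function.comp_apply, Equiv.prodAssoc_apply, hf, termP, mono, mul_one]
    rw [zsmul_eq_mul, zsmul_eq_mul, zsmul_eq_mul, Int.cast_mul]
    have hk := cosetInd_mul_kernel_eq P hP m.1 m.2 x
    calc ((cosetInd N (m.2 + x - m.1) : ℝ) * (p m.1 : ℝ)) * (w m.1 * P (x + m.2) x * w' x)
        = (p m.1 : ℝ) * w m.1 * ((cosetInd N (m.2 + x - m.1) : ℝ) * P (x + m.2) x) * w' x := by ring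
      _ = (p m.1 : ℝ) * w m.1 * ((cosetInd N (x - (m.1 - m.2)) : ℝ) * P m.1 (m.1 - m.2)) * w' x := by rw [hk]
      _ = (p m.1 : ℝ) * (w m.1 * P m.1 (m.1 - m.2) * ((cosetInd N (x - (m.1 - m.2)) : ℝ) * w' x)) := by ring
  exact hF.prod_fiberwise hfib

/-- Block periodicity of the ROW SUMS `R₀ b = Σ_{s'} P b s'`. [folklore] -/
theorem rowSum_add_zsmul (hP : IsBlockPeriodic N P) {R₀ : (Fin d → ℤ) → ℝ} (hrow : ∀ b, HasSum (P b) (R₀ b))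
    (b z : Fin d → ℤ) : R₀ (b + (N : ℤ) • z) = R₀ b := by
  have h1 : HasSum (fun s' => P (b + (N : ℤ) • z) (s' + (N : ℤ) • z)) (R₀ (b + (N : ℤ) • z)) :=
    (Equiv.hasSum_iff (Equiv.addRight ((N : ℤ) • z))).mpr (hrow (b + (N : ℤ) • z))
  simp only [hP z] at h1
  exact h1.unique (hrow b)

/-- **RIGHT COLLAPSE WITH CLASS SPLITTING** (`0 < N`): with the row sums `R₀ b = Σ_{s'} P b s'` and the coset
`p`-moments `π a = Σ_u (cosetInd N (a − u) · p u) • w u` of the LEFT pattern, the triple family with weight `p u · 1 · 1`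
has the sum `σ' · Σ_{b : classes} R₀ b · π b`. [folklore] -/
theorem hasSum_termP_right (hN : 0 < N) (hP : IsBlockPeriodic N P) {σ' : ℝ} (hR0 : ConstReproSum N w' σ')
    (p : (Fin d → ℤ) → ℤ) {R₀ : (Fin d → ℤ) → ℝ} (hrow : ∀ b, HasSum (P b) (R₀ b))
    {π : (Fin d → ℤ) → ℝ} (hp : ∀ a, HasSum (fun u => (cosetInd N (a - u) * p u) • w u) (π a))
    (hS : Summable (termP N w P w' (mono p (fun _ => 1) (fun _ => 1)))) :
    HasSum (termP N w P w' (mono p (fun _ => 1) (fun _ => 1)))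
      (σ' * ∑ b : Fin d → Fin N, R₀ (resSite b) * π (resSite b)) := by
  have hG := hasSum_fibre_rightP w P w' hP ((constReproSum_iff_right N w' σ').1 hR0) p hS
  have hfib : ∀ u : Fin d → ℤ,
      HasSum (fun t => (p u • w u) * (P u (u - t) * σ')) ((p u • w u) * (σ' * R₀ u)) := by
    intro u
    have h := (Equiv.hasSum_iff (Equiv.subLeft u)).mpr (hrow u)
    rw [mul_comm σ' (R₀ u)]
    exact ((h.mul_right σ').mul_left (p u • w u)).congr_fun (fun t => by
      simp only [Function.comp_apply, Equiv.subLeft_apply])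
  have hU := hG.prod_fiberwise hfib
  exact hU.unique (hasSum_classSplit hN hp (rowSum_add_zsmul P hP hrow) σ') ▸ hS.hasSum

/-- RIGHT COLLAPSE WHEN EVERY ROW SUM VANISHES (`Σ_{s'} P b s' = 0` for all `b`: the kernel kills constants on the
right): the triple family with weight `p u · 1 · 1` has the sum `0`, with no hypothesis on the `p`-moments of `w`.
[folklore] -/
theorem hasSum_termP_right_of_zero (hP : IsBlockPeriodic N P) {σ' : ℝ} (hR0 : ConstReproSum N w' σ')
    (p : (Fin d → ℤ) → ℤ) (hrow : ∀ b, HasSum (P b) 0)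
    (hS : Summable (termP N w P w' (mono p (fun _ => 1) (fun _ => 1)))) :
    HasSum (termP N w P w' (mono p (fun _ => 1) (fun _ => 1))) 0 := by
  have hG := hasSum_fibre_rightP w P w' hP ((constReproSum_iff_right N w' σ').1 hR0) p hS
  have hfib : ∀ u : Fin d → ℤ, HasSum (fun t => (p u • w u) * (P u (u - t) * σ')) 0 := by
    intro u
    have h := (Equiv.hasSum_iff (Equiv.subLeft u)).mpr (hrow u)
    have h' := (h.mul_right σ').mul_left (p u • w u)
    rw [zero_mul, mul_zero] at h'
    exact h'.congr_fun (fun t => by simp only [Function.comp_apply, Equiv.subLeft_apply])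
  have h0 : HasSum (fun _ : Fin d → ℤ => (0 : ℝ)) (∑' s, termP N w P w' (mono p (fun _ => 1) (fun _ => 1)) s) :=
    hG.prod_fiberwise hfib
  exact h0.unique hasSum_zero ▸ hS.hasSum

end Collapse

end Summit.QuantumFields.BalabanUV.Beta.D1BFx.MomentTransferPeriodic
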